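import Mathlib
import Literature.LinearAlgebra.Matrix.BipartiteForestCofactor
import Literature.LinearAlgebra.Matrix.AdjugateRankOne
import Literature.NumberTheory.EllipticCurves.Smith2016.CongruentNumberGenusDeterminantBlocks
import Literature.NumberTheory.EllipticCurves.Smith2016.CongruentNumberRedeiDeterminantEven

/-!
# Smith's lemma `det P(A, y, z) = det (A + D_z)` for `Σ y = 0`, and the block weight `g(2d)` (row 2)

A. Smith, *The congruent numbers have positive natural density*, arXiv:1603.08479, §2.2
[Smith2016CongruentDensity] (chunk p0009 L11 – p0010 L8): for `P(A, y, z) = [[D_{y+z}, Aᵀ],[A, D_z]]`,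
"we claim that the determinant of this equals `det (A + D_z)` if `Σᵢ yᵢ = 0`", and then (Table 1, row
`n ≡ 2 (4)`) "if `d | n` corresponds to `S` and `d ≡ 1 (4)`, then `det P(A, y, z)[S] = g(2d)`" — the
block weight of row 2 of Thm. 2.2.  Smith argues with even ranks of alternating matrices; here is a
proof by the adjugate calculus of `Literature/LinearAlgebra/Matrix/AdjugateRankOne` and the pointed
forest formula (`BipartiteForestCofactor`), for ANY arc weights `a` on a block `S` satisfying the
reciprocity relation `a i j + a j i = t i t j` (`i ≠ j`), `Σ_S t = 0`:

* `conj_bigN_mark_add` — `P(A, t, z)[S]` (the doubled forest matrix with marks `t + z`, roots `z`, no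
  extra roots) is congruent to `N₁ + u uᵀ`, `N₁ = bigN a S 0 z z = [[0, Cᵀ],[C, D_z]]` (`C = A + D_z`),
  `u = (t·1_S ; 0)`;
* `det_bigN_mark_add_eq_det_lap` — **`det P = det N₁ = det (A + D_z)`**: with `w = (1_S; 1_S)` one has
  `u = N₁ w + v`, `v = (z·1_S; 0)` (column sums `1ᵀC = t + z` by reciprocity and `Σ_S t = 0`, row sums
  `C·1 = z`), so `uᵀ adj(N₁) u = det N₁ · (wᵀ N₁ w) + vᵀ adj(N₁) v = det N₁ · z_S + z_S · det N₁ = 0`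
  (the cross terms cancel in characteristic `2`; `Σ_j z_j adj(N₁)_{jj} = z_S det N₁` is the additive
  pointing of the unmarked forest sum);
* `det_lap_legendre_eq_genusWeight_two` — for Monsky's `A` of distinct odd primes and any block `S`,
  `det (A^S + D_z) ≡ g(2 d_S) (mod 2)` (Smith's Table 1 row `n ≡ 2 (4)`, `CongruentNumberRedeiDeterminantEven`,
  re-indexed to the sub-tuple);
* `setExp_markWeight_eq_genusWeight_two` — hence, in forest form, for `Σ_S t = 0`:
  `Σ_{π ∈ Part(S)} ∏_{C} (t_C + z_C) q_z(A^C) = g(2 d_S)`.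
-/

namespace Literature.NumberTheory.EllipticCurves.Smith2016

open _root_.Matrix Finset Literature.LinearAlgebra.Matrix Literature.Combinatorics.Enumerative
open Literature.NumberTheory.EllipticCurves.HeathBrown1994
open Literature.NumberTheory.EllipticCurves.TianYuanZhang2017
open Literature.NumberTheory.EllipticCurves.HeathBrown1994.Families (legendreMatrix_apply_of_ne legendreMatrix_apply_self)
open Literature.NumberTheory.EllipticCurves.MonskySelmerParity

section SmithLemma

variable {V : Type*} [Fintype V] [DecidableEq V]

omit [Fintype V] in
/-- Root weights enter the Laplacian-type block through its diagonal: `P_ℓ = P_0 + diag(ℓ · 1_S)`.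
[cite: Chaiken1982, §2 (the matrix of the all minors matrix tree theorem)] -/
theorem lapIn_eq_add_diagonal (a : V → V → ZMod 2) (S : Finset V) (ℓ : V → ZMod 2) :
    lapIn a S ℓ = lapIn a S 0 + diagonal (fun i => if i ∈ S then ℓ i else 0) := by
  ext i j
  rw [Matrix.add_apply, lapIn_apply, lapIn_apply, diagonal_apply]
  by_cases h : i ∈ S ∧ j ∈ S
  · rw [if_pos h, if_pos h]
    by_cases hij : i = j
    · subst hij; rw [if_pos rfl, if_pos rfl, if_pos rfl, if_pos h.1, Pi.zero_apply, zero_add, add_comm]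
    · rw [if_neg hij, if_neg hij, if_neg hij, add_zero]
  · rw [if_neg h, if_neg h, zero_add]
    by_cases hij : i = j
    · subst hij
      rw [if_pos rfl, if_neg (fun hi => h ⟨hi, hi⟩)]
    · rw [if_neg hij]

omit [Fintype V] in
/-- `P_0` vanishes outside `S × S`. [cite: Chaiken1982, §2] -/
theorem lapIn_eq_zero_of_not_mem (a : V → V → ZMod 2) (S : Finset V) (ℓ : V → ZMod 2) {i j : V}
    (h : ¬ (i ∈ S ∧ j ∈ S)) : lapIn a S ℓ i j = 0 := by
  rw [lapIn_apply, if_neg h]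

/-- **The congruence `E · P(A, t, z)[S] · Eᵀ = N₁ + u uᵀ`** with `E = [[I, 1_S],[0, I]]`: for arc weights
with the reciprocity relation `a i j + a j i = t i t j` on `S`,
`[[I, 1_S],[0, I]] · [[D_{t+z}, P_0ᵀ],[P_0, D_z]] · [[I, 0],[1_S, I]] = [[0, P_zᵀ],[P_z, D_z]] + (t 1_S; 0)(t 1_S; 0)ᵀ`
(ambient form: unit diagonal outside `S`).
[cite: Smith2016CongruentDensity, §2.2 (chunk p0009 L40–L48: "with elementary row and column operations, det P = |yyᵀ, Aᵀ + D_z; A + D_z, D_z|")] -/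
theorem conj_bigN_mark_add (a : V → V → ZMod 2) (S : Finset V) (t z : V → ZMod 2)
    (hrec : ∀ i ∈ S, ∀ j ∈ S, i ≠ j → a i j + a j i = t i * t j) :
    fromBlocks 1 (diagonal fun i => if i ∈ S then (1 : ZMod 2) else 0) 0 1 *
        bigN a S (fun i => t i + z i) z 0 *
        fromBlocks 1 0 (diagonal fun i => if i ∈ S then (1 : ZMod 2) else 0) 1 =
      bigN a S 0 z z +
        vecMulVec (Sum.elim (fun i => if i ∈ S then t i else 0) (0 : V → ZMod 2))
          (Sum.elim (fun i => if i ∈ S then t i else 0) (0 : V → ZMod 2)) := by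
  have h3 : ∀ x y c : ZMod 2, x + y + c + c + y = x * x := by decide
  -- the indicator diagonal `X = diag 1_S` and its products
  have F1 : diagonal (fun i => if i ∈ S then (1 : ZMod 2) else 0) * lapIn a S 0 = lapIn a S 0 := by
    ext i j
    rw [diagonal_mul]
    by_cases hi : i ∈ S
    · rw [if_pos hi, one_mul]
    · rw [if_neg hi, zero_mul, lapIn_eq_zero_of_not_mem a S 0 (fun h => hi h.1)]
  have F2 : (lapIn a S 0)ᵀ * diagonal (fun i => if i ∈ S then (1 : ZMod 2) else 0) = (lapIn a S 0)ᵀ := by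
    ext i j
    rw [mul_diagonal, transpose_apply]
    by_cases hj : j ∈ S
    · rw [if_pos hj, mul_one]
    · rw [if_neg hj, mul_zero, lapIn_eq_zero_of_not_mem a S 0 (fun h => hj h.1)]
  have F3 : diagonal (fun i => if i ∈ S then (1 : ZMod 2) else 0) *
      diagonal (fun i => if i ∈ S then z i else 1) = diagonal (fun i => if i ∈ S then z i else 0) := by
    rw [diagonal_mul_diagonal]
    congr 1; funext i
    by_cases hi : i ∈ S
    · rw [if_pos hi, if_pos hi, if_pos hi, one_mul]
    · simp [hi]
  have F3' : diagonal (fun i => if i ∈ S then z i else 1) *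
      diagonal (fun i => if i ∈ S then (1 : ZMod 2) else 0) = diagonal (fun i => if i ∈ S then z i else 0) := by
    rw [diagonal_mul_diagonal]
    congr 1; funext i
    by_cases hi : i ∈ S
    · rw [if_pos hi, if_pos hi, if_pos hi, mul_one]
    · simp [hi]
  have F4 : diagonal (fun i => if i ∈ S then (1 : ZMod 2) else 0) *
      diagonal (fun i => if i ∈ S then z i else 1) *
      diagonal (fun i => if i ∈ S then (1 : ZMod 2) else 0) = diagonal (fun i => if i ∈ S then z i else 0) := by
    rw [F3, diagonal_mul_diagonal]
    congr 1; funext i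
    by_cases hi : i ∈ S
    · rw [if_pos hi, if_pos hi, mul_one]
    · simp [hi]
  -- the content: `D_{t+z} + P_0 + P_0ᵀ + diag(z 1_S) = diag(0 on S, 1 off S) + (t 1_S)(t 1_S)ᵀ`
  have F5 : diagonal (fun i => if i ∈ S then t i + z i else 1) + lapIn a S 0 + (lapIn a S 0)ᵀ +
      diagonal (fun i => if i ∈ S then z i else 0) =
      diagonal (fun i => if i ∈ S then (0 : V → ZMod 2) i else 1) +
        vecMulVec (fun i => if i ∈ S then t i else 0) (fun i => if i ∈ S then t i else 0) := by
    ext i j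
    simp only [Matrix.add_apply, diagonal_apply, transpose_apply, vecMulVec_apply, Pi.zero_apply]
    by_cases hij : i = j
    · subst hij
      by_cases hi : i ∈ S
      · simp only [if_true, if_pos hi]
        rw [lapIn_apply, if_pos ⟨hi, hi⟩, if_pos rfl, Pi.zero_apply, zero_add, zero_add]
        exact h3 _ _ _
      · simp only [if_true, if_neg hi, mul_zero, add_zero]
        rw [lapIn_eq_zero_of_not_mem a S 0 (fun h => hi h.1), add_zero, add_zero]
    · simp only [if_neg hij, zero_add, add_zero]
      by_cases hi : i ∈ S
      · by_cases hj : j ∈ S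
        · rw [if_pos hi, if_pos hj, lapIn_apply, if_pos ⟨hi, hj⟩, if_neg hij, lapIn_apply,
            if_pos ⟨hj, hi⟩, if_neg (Ne.symm hij), hrec i hi j hj hij]
        · rw [if_pos hi, if_neg hj, mul_zero, lapIn_eq_zero_of_not_mem a S 0 (fun h => hj h.2),
            lapIn_eq_zero_of_not_mem a S 0 (fun h => hj h.1), add_zero]
      · rw [if_neg hi, zero_mul, lapIn_eq_zero_of_not_mem a S 0 (fun h => hi h.1),
          lapIn_eq_zero_of_not_mem a S 0 (fun h => hi h.2), add_zero]
  have hvec : vecMulVec (Sum.elim (fun i => if i ∈ S then t i else 0) (0 : V → ZMod 2))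
      (Sum.elim (fun i => if i ∈ S then t i else 0) (0 : V → ZMod 2)) =
      fromBlocks (vecMulVec (fun i => if i ∈ S then t i else 0) (fun i => if i ∈ S then t i else 0))
        0 0 (0 : Matrix V V (ZMod 2)) := by
    ext (i | i) (j | j) <;> simp [vecMulVec_apply]
  rw [bigN, bigN, fromBlocks_multiply, fromBlocks_multiply, hvec, fromBlocks_add]
  simp only [Matrix.mul_one, Matrix.one_mul, Matrix.zero_mul, Matrix.mul_zero, add_zero, zero_add,
    Matrix.add_mul]
  refine fromBlocks_inj.mpr ⟨?_, ?_, ?_, ?_⟩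
  · rw [F1, F2, F4, ← F5]
    abel
  · rw [F3, lapIn_eq_add_diagonal a S z, transpose_add, diagonal_transpose]
  · rw [F3', lapIn_eq_add_diagonal a S z]
  · rfl

/-- `det P(A, t, z)[S] = det (N₁ + u uᵀ)` (the congruence has unimodular factors).
[cite: Smith2016CongruentDensity, §2.2 (chunk p0009 L40–L48)] -/
theorem det_bigN_mark_add_eq (a : V → V → ZMod 2) (S : Finset V) (t z : V → ZMod 2)
    (hrec : ∀ i ∈ S, ∀ j ∈ S, i ≠ j → a i j + a j i = t i * t j) :
    (bigN a S (fun i => t i + z i) z 0).det =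
      (bigN a S 0 z z +
        vecMulVec (Sum.elim (fun i => if i ∈ S then t i else 0) (0 : V → ZMod 2))
          (Sum.elim (fun i => if i ∈ S then t i else 0) (0 : V → ZMod 2))).det := by
  rw [← conj_bigN_mark_add a S t z hrec, det_mul, det_mul, det_fromBlocks_zero₂₁, det_fromBlocks_zero₁₂]
  simp

/-- Sums of an indicator-weighted function over the ambient type are sums over `S`. [cite: Chaiken1982, §2] -/
theorem sum_mul_indicator (f : V → ZMod 2) (S : Finset V) :
    ∑ j, f j * (if j ∈ S then (1 : ZMod 2) else 0) = ∑ j ∈ S, f j := by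
  simp only [mul_ite, mul_one, mul_zero]
  rw [← sum_filter, filter_mem_eq_inter, univ_inter]

/-- **`N₁ · (1_S; 1_S) = ((t + z)·1_S; 0)`** for `N₁ = [[0, P_zᵀ],[P_z, D_z]]` (ambient): the columns of the
Laplacian block sum to `t` on `S` by reciprocity and `Σ_S t = 0`, its rows sum to `0`.
[cite: Smith2016CongruentDensity, §2.2 (chunk p0009 L26–L30: "(y + z, z) is the sum of the columns of P")] -/
theorem bigN_zero_mulVec_indicator (a : V → V → ZMod 2) (S : Finset V) (t z : V → ZMod 2)
    (hrec : ∀ i ∈ S, ∀ j ∈ S, i ≠ j → a i j + a j i = t i * t j) (htS : ∑ i ∈ S, t i = 0) :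
    bigN a S 0 z z *ᵥ Sum.elim (fun i => if i ∈ S then (1 : ZMod 2) else 0)
        (fun i => if i ∈ S then (1 : ZMod 2) else 0) =
      Sum.elim (fun i => if i ∈ S then t i + z i else 0) (0 : V → ZMod 2) := by
  have hsq : ∀ c : ZMod 2, c * c = c := by decide
  have h2 : ∀ c : ZMod 2, c + c = 0 := by decide
  have hl : Sum.elim (fun i => if i ∈ S then (1 : ZMod 2) else 0) (fun i => if i ∈ S then (1 : ZMod 2) else 0)
      ∘ Sum.inl = fun i => if i ∈ S then (1 : ZMod 2) else 0 := rfl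
  have hr : Sum.elim (fun i => if i ∈ S then (1 : ZMod 2) else 0) (fun i => if i ∈ S then (1 : ZMod 2) else 0)
      ∘ Sum.inr = fun i => if i ∈ S then (1 : ZMod 2) else 0 := rfl
  rw [bigN, fromBlocks_mulVec, hl, hr]
  -- the row sum of the Laplacian block over `S` is `z i`, the column sum is `t i + z i`
  have hrow : ∀ i ∈ S, ∑ j ∈ S, lapIn a S z i j = z i := by
    intro i hi
    have hoff : ∀ j ∈ S.erase i, lapIn a S z i j = a i j := fun j hj => by
      rw [lapIn_apply, if_pos ⟨hi, mem_of_mem_erase hj⟩, if_neg (ne_of_mem_erase hj).symm]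
    rw [← add_sum_erase S _ hi, sum_congr rfl hoff, lapIn_apply, if_pos ⟨hi, hi⟩, if_pos rfl,
      add_assoc, h2, add_zero]
  have hterase : ∀ i ∈ S, ∑ j ∈ S.erase i, t j = t i := by
    intro i hi
    have h := add_sum_erase S t hi
    rw [htS] at h
    have h3 : ∀ x y : ZMod 2, x + y = 0 → y = x := by decide
    exact h3 _ _ h
  have hcol : ∀ i ∈ S, ∑ j ∈ S, lapIn a S z j i = t i + z i := by
    intro i hi
    have hoff' : ∀ j ∈ S.erase i, lapIn a S z j i = a j i := fun j hj => by
      rw [lapIn_apply, if_pos ⟨mem_of_mem_erase hj, hi⟩, if_neg (ne_of_mem_erase hj)]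
    rw [← add_sum_erase S _ hi, sum_congr rfl hoff', lapIn_apply, if_pos ⟨hi, hi⟩, if_pos rfl]
    have hpair : ∑ k ∈ S.erase i, a i k + ∑ j ∈ S.erase i, a j i = t i := by
      rw [← sum_add_distrib, sum_congr rfl fun j hj => hrec i hi j (mem_of_mem_erase hj)
        (ne_of_mem_erase hj).symm, ← mul_sum, hterase i hi, hsq]
    calc z i + ∑ k ∈ S.erase i, a i k + ∑ j ∈ S.erase i, a j i
        = z i + (∑ k ∈ S.erase i, a i k + ∑ j ∈ S.erase i, a j i) := by ring
      _ = t i + z i := by rw [hpair, add_comm]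
  ext (i | i)
  · rw [Sum.elim_inl, Pi.add_apply, Sum.elim_inl, mulVec_diagonal, mulVec, dotProduct]
    simp only [transpose_apply]
    rw [sum_mul_indicator]
    by_cases hi : i ∈ S
    · simp only [if_pos hi, Pi.zero_apply, zero_mul, zero_add, hcol i hi]
    · simp only [if_neg hi, mul_zero, zero_add]
      exact sum_eq_zero fun j _ => lapIn_eq_zero_of_not_mem a S z (fun h => hi h.2)
  · rw [Sum.elim_inr, Pi.add_apply, Sum.elim_inr, mulVec_diagonal, mulVec, dotProduct, Pi.zero_apply,
      sum_mul_indicator]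
    by_cases hi : i ∈ S
    · simp only [if_pos hi, mul_one, hrow i hi, h2]
    · simp only [if_neg hi, mul_zero, add_zero]
      exact sum_eq_zero fun j _ => lapIn_eq_zero_of_not_mem a S z (fun h => hi h.1)

end SmithLemma

section SmithLemmaDet

variable {V : Type*} [Fintype V] [LinearOrder V]

/-- **Smith's lemma, case `Σ y = 0`: `det P(A, t, z)[S] = det (A^S + D_z)`** — for arc weights with the
reciprocity relation on `S` and `Σ_S t = 0`, the doubled forest matrix with marks `t + z`, roots `z` and
no extra roots has the determinant of the Laplacian-type block with root weights `z`.
[cite: Smith2016CongruentDensity, §2.2 (chunk p0009 L11–L60, p0010 L1: "Then det P(A, z, y) = det C = det (A + D_z) when Σᵢ yᵢ = 0")] -/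
theorem det_bigN_mark_add_eq_det_lap (a : V → V → ZMod 2) (S : Finset V) (t z : V → ZMod 2)
    (hrec : ∀ i ∈ S, ∀ j ∈ S, i ≠ j → a i j + a j i = t i * t j) (htS : ∑ i ∈ S, t i = 0) :
    (bigN a S (fun i => t i + z i) z 0).det = (lap a S z).det := by
  classical
  have h2 : ∀ c : ZMod 2, c + c = 0 := by decide
  set N₁ := bigN a S 0 z z with hN₁
  set u : V ⊕ V → ZMod 2 := Sum.elim (fun i => if i ∈ S then t i else 0) (0 : V → ZMod 2) with hu
  set w : V ⊕ V → ZMod 2 := Sum.elim (fun i => if i ∈ S then (1 : ZMod 2) else 0)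
    (fun i => if i ∈ S then (1 : ZMod 2) else 0) with hw
  set v : V ⊕ V → ZMod 2 := Sum.elim (fun i => if i ∈ S then z i else 0) (0 : V → ZMod 2) with hv
  have hsymm : N₁ᵀ = N₁ := bigN_transpose a S 0 z z
  have hadjT : (N₁.adjugate)ᵀ = N₁.adjugate := by rw [adjugate_transpose, hsymm]
  have hNw : N₁ *ᵥ w = Sum.elim (fun i => if i ∈ S then t i + z i else 0) (0 : V → ZMod 2) :=
    bigN_zero_mulVec_indicator a S t z hrec htS
  have hU : u = N₁ *ᵥ w + v := by
    rw [hNw]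
    ext (i | i)
    · simp only [hu, hv, Sum.elim_inl, Pi.add_apply]
      by_cases hi : i ∈ S
      · rw [if_pos hi, if_pos hi, if_pos hi, add_assoc, h2, add_zero]
      · rw [if_neg hi, if_neg hi, if_neg hi, add_zero]
    · simp [hu, hv]
  -- the four terms of `uᵀ adj(N₁) u`
  have hadjN : N₁.adjugate *ᵥ (N₁ *ᵥ w) = N₁.det • w := by
    rw [mulVec_mulVec, adjugate_mul, smul_mulVec, one_mulVec]
  have hNadj : N₁ *ᵥ (N₁.adjugate *ᵥ v) = N₁.det • v := by
    rw [mulVec_mulVec, mul_adjugate, smul_mulVec, one_mulVec]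
  have hT2 : (N₁ *ᵥ w) ⬝ᵥ (N₁.adjugate *ᵥ v) = N₁.det * (v ⬝ᵥ w) := by
    rw [dotProduct_comm, dotProduct_mulVec, ← mulVec_transpose, hsymm, hNadj, smul_dotProduct, smul_eq_mul]
  have hT3 : v ⬝ᵥ (N₁.det • w) = N₁.det * (v ⬝ᵥ w) := by rw [dotProduct_smul, smul_eq_mul]
  have hwNw : (N₁ *ᵥ w) ⬝ᵥ w = ∑ i ∈ S, z i := by
    rw [hNw, dotProduct, Fintype.sum_sum_type]
    simp only [Sum.elim_inl, Sum.elim_inr, Pi.zero_apply, zero_mul, sum_const_zero, add_zero, hw]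
    rw [sum_mul_indicator]
    have hif : ∑ j ∈ S, (if j ∈ S then t j + z j else 0) = ∑ j ∈ S, (t j + z j) :=
      sum_congr rfl fun j hj => if_pos hj
    rw [hif, sum_add_distrib, htS, zero_add]
  have hT1 : (N₁ *ᵥ w) ⬝ᵥ (N₁.det • w) = N₁.det * ∑ i ∈ S, z i := by
    rw [dotProduct_smul, smul_eq_mul, hwNw]
  have hT4 : v ⬝ᵥ (N₁.adjugate *ᵥ v) = (∑ i ∈ S, z i) * N₁.det := by
    rw [dotProduct_mulVec_eq_sum_diag hadjT, Fintype.sum_sum_type]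
    simp only [hv, Sum.elim_inl, Sum.elim_inr, Pi.zero_apply, mul_zero, sum_const_zero, add_zero]
    rw [← sum_mul_adjugate_bigN_zero_inl a S z z]
    simp only [mul_ite, mul_zero]
    rw [← sum_filter, filter_mem_eq_inter, univ_inter]
    exact sum_congr rfl fun i _ => mul_comm _ _
  rw [det_bigN_mark_add_eq a S t z hrec, det_add_vecMulVec, ← hN₁, ← hu, hU, mulVec_add, add_dotProduct,
    dotProduct_add, dotProduct_add, hadjN, hT1, hT2, hT3, hT4]
  have hcancel : N₁.det * (∑ i ∈ S, z i) + N₁.det * (v ⬝ᵥ w) +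
      (N₁.det * (v ⬝ᵥ w) + (∑ i ∈ S, z i) * N₁.det) = 0 := by
    calc N₁.det * (∑ i ∈ S, z i) + N₁.det * (v ⬝ᵥ w) + (N₁.det * (v ⬝ᵥ w) + (∑ i ∈ S, z i) * N₁.det)
        = (N₁.det * (∑ i ∈ S, z i) + N₁.det * (∑ i ∈ S, z i)) +
          (N₁.det * (v ⬝ᵥ w) + N₁.det * (v ⬝ᵥ w)) := by ring
      _ = 0 := by rw [h2, h2, add_zero]
  rw [hcancel, add_zero, hN₁, det_bigN_eq_setExp, fwt_zero_left, ← det_lap_eq_setExp]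

end SmithLemmaDet

section Dictionary

variable {k : ℕ} (p : Fin k → ℕ)

/-- **Reciprocity for the arc weights of Monsky's `A`**: `A_ij + A_ji = t_i t_j` for `i ≠ j`, `t_i = (−1/p_i)₊`
(Monsky's display (31)). [cite: HeathBrown1994SelmerCongruentII, Appendix (Monsky), display (31), typescript p. 39 L37–L41] -/
theorem legendreMatrix_add_swap (hp : ∀ i, (p i).Prime) (hodd : ∀ i, Odd (p i))
    (hinj : Function.Injective p) {i j : Fin k} (hij : i ≠ j) :
    legendreMatrix p i j + legendreMatrix p j i = addLegendreSym (-1) (p i) * addLegendreSym (-1) (p j) := by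
  have h := congrFun (congrFun (legendreMatrix_add_transpose p hp (ne_two_of_odd p hodd) hinj) i) j
  rw [Matrix.add_apply, transpose_apply, Matrix.add_apply, legendreDiagonal, diagonal_apply_ne _ hij,
    zero_add, vecMulVec_apply] at h
  exact h

/-- **Re-indexing a principal block to Monsky's matrix of the sub-tuple**: for a block `S`,
`det (A^S + D_z)` (ambient form `lap`, identity outside `S`) equals `det (legendreMatrix q + legendreDiagonal q 2)`
for the sub-tuple `q = p|_S`. [cite: Smith2016CongruentDensity, §2.1 Remark 2.3 ("the M_x that corresponds to d is M_x(A, z)[S]")] -/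
theorem det_lap_legendre_eq_subtuple (S : Finset (Fin k)) :
    (lap (fun i j => legendreMatrix p i j) S (fun i => addLegendreSym 2 (p i))).det =
      (legendreMatrix (fun x : Fin S.card => p ((S.equivFin.symm x : {i // i ∈ S}) : Fin k)) +
        legendreDiagonal (fun x : Fin S.card => p ((S.equivFin.symm x : {i // i ∈ S}) : Fin k)) 2).det := by
  set M := lap (fun i j => legendreMatrix p i j) S (fun i => addLegendreSym 2 (p i)) with hM
  set e := S.equivFin with he
  have h0 : ∀ i, ¬ (i ∈ S) → ∀ j, j ∈ S → M i j = 0 := by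
    intro i hi j hj
    have hij : i ≠ j := fun h => hi (by rw [h]; exact hj)
    rw [hM, lap_apply, if_neg (fun h => hi h.1), if_neg hij]
  have h1 : M.toSquareBlockProp (fun i => ¬ i ∈ S) = 1 := by
    ext ⟨i, hi⟩ ⟨j, hj⟩
    rw [toSquareBlockProp_def, of_apply, hM, lap_apply, if_neg (fun h => hi h.1), one_apply]
    by_cases hij : i = j
    · subst hij; simp
    · rw [if_neg hij, if_neg (fun h => hij (congrArg Subtype.val h))]
  have h5 : (M.toSquareBlockProp (fun a => a ∈ S)).submatrix e.symm e.symm =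
      legendreMatrix (fun x : Fin S.card => p ((S.equivFin.symm x : {i // i ∈ S}) : Fin k)) +
        legendreDiagonal (fun x : Fin S.card => p ((S.equivFin.symm x : {i // i ∈ S}) : Fin k)) 2 := by
    ext x y
    rw [submatrix_apply, toSquareBlockProp_def, of_apply, hM, lap_apply,
      if_pos (And.intro (e.symm x).2 (e.symm y).2), Matrix.add_apply, legendreDiagonal, diagonal_apply]
    by_cases hxy : x = y
    · subst hxy
      have hx : ((e.symm x : {i // i ∈ S}) : Fin k) ∈ S := (e.symm x).2
      rw [if_pos rfl, if_pos rfl, legendreMatrix_apply_self,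
        sum_congr rfl fun j hj => legendreMatrix_apply_of_ne _ (ne_of_mem_erase hj).symm,
        sum_congr rfl fun j hj => legendreMatrix_apply_of_ne _ (ne_of_mem_erase hj).symm,
        sum_erase_eq_sub hx, sum_erase_eq_sub (mem_univ x), add_comm, he,
        ← sum_subtuple p S (fun n => addLegendreSym n (p ((S.equivFin.symm x : {i // i ∈ S}) : Fin k)))]
    · have hne : ((e.symm x : {i // i ∈ S}) : Fin k) ≠ ((e.symm y : {i // i ∈ S}) : Fin k) :=
        fun h => hxy (e.symm.injective (Subtype.ext h))
      rw [if_neg hne, if_neg hxy, add_zero, legendreMatrix_apply_of_ne p hne, legendreMatrix_apply_of_ne _ hxy, he]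
  have h2 := Matrix.twoBlockTriangular_det M (fun a => a ∈ S) h0
  have h4 := det_submatrix_equiv_self e.symm (M.toSquareBlockProp (fun a => a ∈ S))
  rw [h5] at h4
  rw [h2, h1, det_one, mul_one]
  convert h4.symm using 2

/-- **Block weight of row 2: `det (A^S + D_z) ≡ g(2 d_S) (mod 2)`** for every block `S` of a tuple of
distinct odd primes (Smith's Table 1, row `n ≡ 2 (4)`, via Rédei–Reichardt on the sub-tuple).
[cite: Smith2016CongruentDensity, §2 Table 1 row n ≡ 2 (4) and §2.2 (chunk p0010 L1–L8: "det P(A, y, z)[S] = g(2d)")] -/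
theorem det_lap_legendre_eq_genusWeight_two (hp : ∀ i, (p i).Prime) (hodd : ∀ i, Odd (p i))
    (hinj : Function.Injective p) (S : Finset (Fin k)) :
    (lap (fun i j => legendreMatrix p i j) S (fun i => addLegendreSym 2 (p i))).det =
      ((genusClassNumber (GenusField (2 * ∏ i ∈ S, p i)) : ℕ) : ZMod 2) := by
  set q : Fin S.card → ℕ := fun x => p ((S.equivFin.symm x : {i // i ∈ S}) : Fin k) with hq
  have hqp : ∀ x, (q x).Prime := fun x => hp _
  have hqo : ∀ x, Odd (q x) := fun x => hodd _
  have hqinj : Function.Injective q := fun x y h =>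
    S.equivFin.symm.injective (Subtype.ext (hinj h))
  have hprod : ∏ x, q x = ∏ i ∈ S, p i := prod_subtuple p S
  rw [det_lap_legendre_eq_subtuple p S]
  symm
  refine natCast_eq_of_odd_iff ?_
  have h := odd_genusClassNumber_genusField_two_mul_iff_det q hqp hqo hqinj
  rw [hprod] at h
  exact h

/-- **Smith's row-2 block weight in forest form**: for a block `S` with `Σ_S tᵢ = 0` (`d_S ≡ 1 (4)`),
`Σ_{π ∈ Part(S)} ∏_{C∈π} (t_C + z_C) · q_z(A^C) = det P(A, t, z)[S] = det (A^S + D_z) ≡ g(2 d_S) (mod 2)`.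
[cite: Smith2016CongruentDensity, §2.2 (chunk p0010 L1–L8)] -/
theorem setExp_markWeight_eq_genusWeight_two (hp : ∀ i, (p i).Prime) (hodd : ∀ i, Odd (p i))
    (hinj : Function.Injective p) (S : Finset (Fin k))
    (htS : ∑ i ∈ S, addLegendreSym (-1) (p i) = 0) :
    setExp (fun C => (∑ i ∈ C, (addLegendreSym (-1) (p i) + addLegendreSym 2 (p i))) *
        qwt (fun i j => legendreMatrix p i j) (fun i => addLegendreSym 2 (p i)) C) S =
      ((genusClassNumber (GenusField (2 * ∏ i ∈ S, p i)) : ℕ) : ZMod 2) := by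
  rw [← det_lap_legendre_eq_genusWeight_two p hp hodd hinj S,
    ← det_bigN_mark_add_eq_det_lap (fun i j => legendreMatrix p i j) S
      (fun i => addLegendreSym (-1) (p i)) (fun i => addLegendreSym 2 (p i))
      (fun i _ j _ hij => legendreMatrix_add_swap p hp hodd hinj hij) htS,
    det_bigN_eq_setExp]
  refine setExp_congr fun C _ _ => ?_
  simp [fwt, qwt]

end Dictionary

end Literature.NumberTheory.EllipticCurves.Smith2016
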